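import Summits.QuantumFields.YangMills.Theses.SourcedPressureJensen

/-!
# Route `SourcedPressureJensen`, item `Assembly` (stmt-QuantumFields-22520): PROVED

WHAT.  `Summit.QuantumFields.YangMills.Theses.SourcedPressureJensen.Assembly`:
`SourcedPressureIncrement → JensenFloor → FloorOfLowerLaw → WeakCouplingRates.XiPow` — pointwise in `(G, r)` the three
items chain to a power-law floor `PolySeparationPlaquetteFloor 4 r.ρ 1 2 A′ κ′`, and the tree's PROVED kernel glue
`WeakCouplingRates.massGapPowerDecayOf_of_polySeparationFloor` (plane `(1, 2)`, `r.continuous`) turns it into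
`MassGapPowerDecayOf 4 r.ρ (A′/2)`, i.e. `XiPow` with `ε = A′/2` (the planner's 8-line script, kernel-checked here).

HONEST LABEL: `XiPow` is the OPEN all-`G` RECORD-label rung R2ξ-G — an UPPER bound `≤ β^{−ε}` on the lattice mass gap of
torus-limit states at weak coupling.  Proving the implication `Assembly` proves NO conjunct of it: the antecedent
`SourcedPressureIncrement` (XL) is open.  Nothing here bears on the Clay mass gap.
-/

set_option autoImplicit false

noncomputable section

open Literature.MathematicalPhysics.QuantumFieldTheory Literature.MathematicalPhysics.QuantumLattice
open Summit.QuantumFields.YangMills.Theorems.WeakCouplingRates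

namespace Summit.QuantumFields.YangMills.Theorems.SourcedPressureJensen

/-- **`Assembly`, PROVED** (item stmt-QuantumFields-22520 of route `SourcedPressureJensen`): KS → KJ → S → `XiPow`, by the kernel
glue `massGapPowerDecayOf_of_polySeparationFloor` at `ε = A′/2`. -/
theorem assembly_proof : Summit.QuantumFields.YangMills.Theses.SourcedPressureJensen.Assembly := by
  intro h1 h2 h3 G _ _ _ _ hG
  letI : MeasurableSpace G := borel G
  haveI : BorelSpace G := ⟨rfl⟩
  intro r
  obtain ⟨A', κ', hA', hκ', hfloor⟩ := h3 G hG r (h2 G hG r (h1 G hG r))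
  exact ⟨A' / 2, by linarith,
    massGapPowerDecayOf_of_polySeparationFloor r.ρ r.continuous (by decide) (by decide) hA' hκ' hfloor⟩

end Summit.QuantumFields.YangMills.Theorems.SourcedPressureJensen

end
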